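import Mathlib
import Summits.NavierStokesRegularity.NavierStokesRegularity.Theorems.FilamentSkeletonRssStadiumOwnContourHolo
import Summits.NavierStokesRegularity.NavierStokesRegularity.Theorems.FilamentSkeletonRssStadiumOwnContourBound
import Summits.NavierStokesRegularity.NavierStokesRegularity.Theorems.FilamentSkeletonRssStadiumOwnRealTotal
import Summits.NavierStokesRegularity.NavierStokesRegularity.Theorems.FilamentSkeletonRssStadiumPartnerReal
import Summits.NavierStokesRegularity.NavierStokesRegularity.Theorems.FilamentSkeletonRssStadiumCplxSum

/-!
# The per-filament CORE of the retyped `StripPropagation` (`TangentSkeletonNearStraightL`, stmt-NavierStokesRegularity-23320, registered stub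
# `stub_stripPropagation` — blueprint item R7′ of `DIAG-addendum2-landed-g2.md`, all but the Γ-asymptotics)

For ONE filament `j` at ONE value of `Γ`, with the stub's data unpacked (`F`, `G` the stadium continuations of `X j`, `Aa j`; the other filaments real,
`C¹`, unit speed, near-straight, separated by `d₀ ≥ 16h`; cores `≥ Λ⁻¹`; the stub's defining equation for `u`; the concrete retype geometry
`16h ≤ hs`, output `S₁₆ = {|Im z| < h, |Re z − c_j| < L + h}`, `0 ≤ Rb ≤ 1/2`, and the plateau log-condition `μ/√A₁ ≤ 2P`), the three clauses of
`StadiumAnalyticBdd h L (c j) B (τ ↦ u X (X j τ))` hold with the EXPLICIT bound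
  `B = (∑ k, |Γγ_k/4π|) · (B_own(h, L, κ, Λ, Rb) + B_partner(d₀))`
(`strip_core`): holomorphy = Theorems.StadiumOwnContourHolo + StadiumPartnerPiece, real agreement = StadiumCplxSum + StadiumOwnRealTotal + StadiumPartnerReal,
bound = StadiumOwnContourBound + StadiumPartnerPiece.  What remains for the retyped stub is ONLY: `h := cs√Γ/16`, `L := Rb√(Γ log Γ)`, `d₀ := ρ√Γ`,
`B ≤ Cu√Γ log Γ` and `μ/√A₁ ≤ 2P` for `Γ ≥ Γ₀` (real asymptotics), and the quantifier packaging.  HONEST FRAMING: bookkeeping for a HYPOTHETICAL filament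
skeleton on the NEGATIVE side of a MODEL route; nothing here bears on Navier–Stokes regularity or blow-up.  `--supports stmt-NavierStokesRegularity-23320`.
-/

set_option linter.dupNamespace false

noncomputable section

namespace Summit.NavierStokesRegularity.NavierStokesRegularity.Theorems.StadiumStripCore

open Set Metric MeasureTheory Complex
open scoped InnerProductSpace Matrix
open Literature.Analysis.FluidPDE
open Summit.NavierStokesRegularity.NavierStokesRegularity.Theorems.StadiumOwnContourHolo
open Summit.NavierStokesRegularity.NavierStokesRegularity.Theorems.StadiumOwnContourBound
open Summit.NavierStokesRegularity.NavierStokesRegularity.Theorems.StadiumOwnRealTotal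
open Summit.NavierStokesRegularity.NavierStokesRegularity.Theorems.StadiumPartnerPiece
open Summit.NavierStokesRegularity.NavierStokesRegularity.Theorems.StadiumPartnerReal
open Summit.NavierStokesRegularity.NavierStokesRegularity.Theorems.StadiumCplxSum

/-- **Per-filament core of the retyped strip propagation.**  See the module docstring. [folklore] -/
theorem strip_core {N : ℕ} {hs h L Rb Λ d₀ Γ : ℝ} {γ : Fin N → ℝ} {X : Fin N → ℝ → EuclideanSpace ℝ (Fin 3)} {c : Fin N → ℝ}
    {Aa : Fin N → ℝ → ℝ} {u : (Fin N → ℝ → EuclideanSpace ℝ (Fin 3)) → EuclideanSpace ℝ (Fin 3) → EuclideanSpace ℝ (Fin 3)}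
    (j : Fin N) {F : ℂ → (Fin 3 → ℂ)} {G : ℂ → ℂ}
    (hu : ∀ Z y, u Z y = ∑ k, (Γ * γ k / (4 * Real.pi)) • ∫ σ : ℝ,
      ((‖y - Z k σ‖ ^ 2 + Real.exp (-(1 + Real.eulerMascheroniConstant - Real.log 2)) * Aa k σ) ^ (3/2 : ℝ))⁻¹ • cross (deriv (Z k) σ) (y - Z k σ))
    (hXc : ∀ k, ContDiff ℝ 2 (X k)) (hXu : ∀ k τ, ‖deriv (X k) τ‖ = 1) (hRb0 : 0 ≤ Rb) (hRb : Rb ≤ 1 / 2)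
    (hosc : ∀ k τ σ, ‖deriv (X k) τ - deriv (X k) σ‖ ≤ Rb)
    (hAd : ∀ k, Differentiable ℝ (Aa k)) (hΛ : 0 < Λ) (hAfloor : ∀ k σ, Λ⁻¹ ≤ Aa k σ)
    (hd₀ : 0 < d₀) (hsep : ∀ k, k ≠ j → ∀ τ σ, d₀ ≤ ‖X j τ - X k σ‖)
    (hF : DifferentiableOn ℂ F {z : ℂ | |z.im| < hs ∧ |z.re - c j| < L + hs})
    (hM : ∀ z ∈ {z : ℂ | |z.im| < hs ∧ |z.re - c j| < L + hs}, ‖deriv F z‖ ≤ 2)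
    (hFX : ∀ r : ℝ, (r : ℂ) ∈ {z : ℂ | |z.im| < hs ∧ |z.re - c j| < L + hs} →
      F r = fun i => ((⟪X j r, EuclideanSpace.single i (1:ℝ)⟫_ℝ : ℝ) : ℂ))
    (hG : DifferentiableOn ℂ G {z : ℂ | |z.im| < hs ∧ |z.re - c j| < L + hs})
    (hGA : ∀ w ∈ {z : ℂ | |z.im| < hs ∧ |z.re - c j| < L + hs}, Aa j w.re / 2 ≤ (G w).re)
    (hGX : ∀ r : ℝ, (r : ℂ) ∈ {z : ℂ | |z.im| < hs ∧ |z.re - c j| < L + hs} → G r = ((Aa j r : ℝ) : ℂ))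
    (hh : 0 < h) (h16 : 16 * h ≤ hs) (hL : 0 < L) (h16d : 16 * h ≤ d₀)
    (hR : √(Real.exp (-(1 + Real.eulerMascheroniConstant - Real.log 2)) / (2 * Λ)) /
        √(1 - (Rb + 2 * (√3 * (2 * 2 * (Real.log ((8:ℝ) / (8 - 1)) - 1 / 8)))) ^ 2 / 2) ≤ (c j + (L + 8 * h)) - (c j - (L + 8 * h))) :
    ∃ U : ℂ → (Fin 3 → ℂ), DifferentiableOn ℂ U {z : ℂ | |z.im| < h ∧ |z.re - c j| < L + h} ∧
      (∀ t : ℝ, (t : ℂ) ∈ {z : ℂ | |z.im| < h ∧ |z.re - c j| < L + h} →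
        U t = fun i => ((⟪u X (X j t), EuclideanSpace.single i (1:ℝ)⟫_ℝ : ℝ) : ℂ)) ∧
      ∀ z ∈ {z : ℂ | |z.im| < h ∧ |z.re - c j| < L + h}, ‖U z‖ ≤ (∑ k, |Γ * γ k / (4 * Real.pi)|) *
        ((5 * 72 * (Real.pi / ((7 / 16) * (3 * h))) +
          4 * (2 * (2 / (7 * h))) * ((1/3 + Real.log (((c j + (L + 8 * h)) - (c j - (L + 8 * h))) *
            √(1 - (Rb + 2 * (√3 * (2 * 2 * (Real.log ((8:ℝ) / (8 - 1)) - 1 / 8)))) ^ 2 / 2) /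
              √(Real.exp (-(1 + Real.eulerMascheroniConstant - Real.log 2)) / (2 * Λ)))) /
            (1 - (Rb + 2 * (√3 * (2 * 2 * (Real.log ((8:ℝ) / (8 - 1)) - 1 / 8)))) ^ 2 / 2) ^ (3/2 : ℝ)) +
          2 * (h * (((7 * h) ^ 2 * ((1 - (2 / 7 : ℝ) ^ 2) * (1 - (Rb + 2 * (√3 * (2 * 2 * (Real.log ((8:ℝ) / (8 - 1)) - 1 / 8)))) ^ 2 / 2) -
            2 * (2 / 7 : ℝ) * (2 * (√3 * (2 * Real.log ((8:ℝ) / (8 - 1)))) * (Rb + 2 * (√3 * (2 * 2 * (Real.log ((8:ℝ) / (8 - 1)) - 1 / 8))))))) ^ (-(3/2 : ℝ)) *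
            (2 * 2 ^ 2 * (2 * L + 11 * h))))) +
         5 * (61 * 16 / 9) * (Real.pi / ((7 / 16) * d₀))) := by
  set κ : ℝ := Real.exp (-(1 + Real.eulerMascheroniConstant - Real.log 2)) with hκdef
  have hκ : 0 < κ := Real.exp_pos _
  set cc : ℝ := c j with hcc
  set S : Set ℂ := {z : ℂ | |z.im| < hs ∧ |z.re - cc| < L + hs} with hS
  set S16 : Set ℂ := {z : ℂ | |z.im| < h ∧ |z.re - cc| < L + h} with hS16
  have hhs : 0 < hs := by linarith
  have hS16S : S16 ⊆ S := fun z hz => ⟨by linarith [hz.1], by linarith [hz.2]⟩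
  have hS16o : IsOpen S16 := isOpen_stadium h (L + h) cc
  -- derived data
  have hX1 : ∀ k, ContDiff ℝ 1 (X k) := fun k => (hXc k).of_le (by norm_num)
  have hXd : ∀ k, Differentiable ℝ (X k) := fun k => (hX1 k).differentiable (by simp)
  have hosc2 : ∀ k τ σ, ‖deriv (X k) τ - deriv (X k) σ‖ ≤ 1 / 2 := fun k τ σ => (hosc k τ σ).trans hRb
  have hAc : ∀ k, Continuous (Aa k) := fun k => (hAd k).continuous
  have hA0 : ∀ k σ, 0 ≤ Aa k σ := fun k σ => le_trans (by positivity) (hAfloor k σ)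
  have hunit := StadiumBilinearUnitSpeed.sum_sq_deriv_eq_one_on_stadium hhs hL hF hFX (hXd j) (hXu j)
  have hGre : ∀ w ∈ S, Λ⁻¹ / 2 ≤ (G w).re := fun w hw => le_trans (by linarith [hAfloor j w.re]) (hGA w hw)
  -- the pieces
  let K : ℂ → ℂ → (Fin 3 → ℂ) := fun z ζ => (((∑ i, (F z i - F ζ i) ^ 2) + (κ : ℂ) * G ζ) ^ ((3:ℂ) / 2))⁻¹ •
      (deriv F ζ ⨯₃ (fun i => F z i - F ζ i))
  let own : ℂ → (Fin 3 → ℂ) := fun z =>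
    (∫ σ in {σ : ℝ | L + 8 * h ≤ |σ - cc|},
        (((∑ i, (F z i - ((X j σ i : ℝ) : ℂ)) ^ 2) + ((κ * Aa j σ : ℝ) : ℂ)) ^ ((3:ℂ) / 2))⁻¹ •
          ((fun i => ((deriv (X j) σ i : ℝ) : ℂ)) ⨯₃ (fun i => F z i - ((X j σ i : ℝ) : ℂ)))) +
      ((∫ σ in (cc - (L + 8 * h))..(cc + (L + 8 * h)), K z ((σ : ℂ) + (z.im : ℂ) * I)) -
        I • (∫ s in (0:ℝ)..z.im, K z (((cc + (L + 8 * h) : ℝ) : ℂ) + (s : ℂ) * I)) +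
        I • (∫ s in (0:ℝ)..z.im, K z (((cc - (L + 8 * h) : ℝ) : ℂ) + (s : ℂ) * I)))
  let partner : Fin N → ℂ → (Fin 3 → ℂ) := fun k z => ∫ σ : ℝ,
      (((∑ i, (F z i - ((X k σ i : ℝ) : ℂ)) ^ 2) + ((κ * Aa k σ : ℝ) : ℂ)) ^ ((3:ℂ) / 2))⁻¹ •
        ((fun i => ((deriv (X k) σ i : ℝ) : ℂ)) ⨯₃ (fun i => F z i - ((X k σ i : ℝ) : ℂ)))
  let piece : Fin N → ℂ → (Fin 3 → ℂ) := fun k z => if k = j then own z else partner k z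
  refine ⟨fun z => ∑ k, (((Γ * γ k / (4 * Real.pi) : ℝ)) : ℂ) • piece k z, ?_, ?_, ?_⟩
  · -- holomorphy
    apply DifferentiableOn.fun_sum
    intro k _
    apply DifferentiableOn.fun_const_smul
    by_cases hk : k = j
    · have hown := own_contour_differentiableOn hF hunit hM (hX1 j) (hXu j) hRb0 hRb (hosc j) hFX hG hGre (hAc j) (hA0 j) hκ hΛ hh h16 hL.le
      refine (hown.congr fun z _ => ?_)
      simp only [piece, if_pos hk]
      rfl
    · have hp := partnerPiece_differentiableOn (hs' := h) hF hM (hXd j) (hXu j) hFX (hX1 k) (hXu k) (hosc2 k) (hAc k) (hA0 k) hκ.le hd₀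
        (hsep k hk) (by linarith) h16d
      refine ((hp.mono fun z hz => ⟨hz.1, by linarith [hz.2]⟩).congr fun z _ => ?_)
      simp only [piece, if_neg hk]
      rfl
  · -- real agreement
    intro t ht
    have htS : |t - cc| < L + hs := by have := ht.2; simp at this; linarith
    have hcplx := cplx_u_eq (X := X) hu j t
    rw [hcplx]
    refine Finset.sum_congr rfl fun k _ => ?_
    congr 1
    by_cases hk : k = j
    · subst hk
      simp only [piece, if_true]
      -- the own contour at a real target: height `0`
      have hown := own_contour_real (P := L + 8 * h) hF hFX (hX1 k) (hXu k) (hosc2 k) (hAc k) hΛ (hAfloor k) hκ hhs (by linarith)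
        (by linarith) htS
      have e0 : ((t : ℂ)).im = 0 := Complex.ofReal_im t
      have einner : (fun i => ((⟪∫ σ : ℝ, ((‖X k t - X k σ‖ ^ 2 + κ * Aa k σ) ^ (3/2 : ℝ))⁻¹ • cross (deriv (X k) σ) (X k t - X k σ),
          EuclideanSpace.single i (1:ℝ)⟫_ℝ : ℝ) : ℂ)) =
          fun i => (((∫ σ : ℝ, ((‖X k t - X k σ‖ ^ 2 + κ * Aa k σ) ^ (3/2 : ℝ))⁻¹ • cross (deriv (X k) σ) (X k t - X k σ)) i : ℝ) : ℂ) := by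
        funext i; rw [Summit.NavierStokesRegularity.NavierStokesRegularity.Theorems.StadiumDeviationPackage.inner_single_eq]
      rw [einner, ← hown]
      simp only [own, e0, Complex.ofReal_zero, zero_mul, add_zero, intervalIntegral.integral_same, smul_zero, sub_zero]
      congr 1
      refine intervalIntegral.integral_congr fun σ hσ => ?_
      have hσtr : |σ - cc| < L + hs := by
        rw [Set.uIcc_of_le (by linarith : cc - (L + 8 * h) ≤ cc + (L + 8 * h))] at hσ
        rw [abs_lt]; constructor <;> linarith [hσ.1, hσ.2]
      have hσS : ((σ : ℝ) : ℂ) ∈ S := ⟨by simpa using hhs, by simpa using hσtr⟩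
      simp only [K, hGX σ hσS, Complex.ofReal_mul]
    · simp only [piece, if_neg hk]
      have einner : (fun i => ((⟪∫ σ : ℝ, ((‖X j t - X k σ‖ ^ 2 + κ * Aa k σ) ^ (3/2 : ℝ))⁻¹ • cross (deriv (X k) σ) (X j t - X k σ),
          EuclideanSpace.single i (1:ℝ)⟫_ℝ : ℝ) : ℂ)) =
          fun i => (((∫ σ : ℝ, ((‖X j t - X k σ‖ ^ 2 + κ * Aa k σ) ^ (3/2 : ℝ))⁻¹ • cross (deriv (X k) σ) (X j t - X k σ)) i : ℝ) : ℂ) := by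
        funext i; rw [Summit.NavierStokesRegularity.NavierStokesRegularity.Theorems.StadiumDeviationPackage.inner_single_eq]
      rw [einner]
      exact partnerPiece_real hFX (hX1 k) (hXu k) (hosc2 k) (hAc k) (hA0 k) hκ.le hd₀ (hsep k hk) hhs htS
  · -- the bound
    intro z hz
    have hown := own_contour_norm_le hF hunit hM (hXd j) (hXu j) hRb0 hRb (hosc j) hFX hGre (hA0 j) hκ hΛ hh h16 hL.le hz hR
    have hpart : ∀ k, k ≠ j → ‖partner k z‖ ≤ 5 * (61 * 16 / 9) * (Real.pi / ((7 / 16) * d₀)) := fun k hk =>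
      partnerPiece_norm_le (hs' := h) hF hM (hXd j) (hXu j) hFX (hXd k) (hXu k) (hosc2 k) (hA0 k) hκ.le hd₀ (hsep k hk) (by linarith) h16d
        ⟨hz.1, by linarith [hz.2]⟩
    set Bown : ℝ := (5 * 72 * (Real.pi / ((7 / 16) * (3 * h))) +
          4 * (2 * (2 / (7 * h))) * ((1/3 + Real.log (((cc + (L + 8 * h)) - (cc - (L + 8 * h))) *
            √(1 - (Rb + 2 * (√3 * (2 * 2 * (Real.log ((8:ℝ) / (8 - 1)) - 1 / 8)))) ^ 2 / 2) / √(κ / (2 * Λ)))) /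
            (1 - (Rb + 2 * (√3 * (2 * 2 * (Real.log ((8:ℝ) / (8 - 1)) - 1 / 8)))) ^ 2 / 2) ^ (3/2 : ℝ)) +
          2 * (h * (((7 * h) ^ 2 * ((1 - (2 / 7 : ℝ) ^ 2) * (1 - (Rb + 2 * (√3 * (2 * 2 * (Real.log ((8:ℝ) / (8 - 1)) - 1 / 8)))) ^ 2 / 2) -
            2 * (2 / 7 : ℝ) * (2 * (√3 * (2 * Real.log ((8:ℝ) / (8 - 1)))) * (Rb + 2 * (√3 * (2 * 2 * (Real.log ((8:ℝ) / (8 - 1)) - 1 / 8))))))) ^ (-(3/2 : ℝ)) *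
            (2 * 2 ^ 2 * (2 * L + 11 * h))))) with hBown
    set Bpart : ℝ := 5 * (61 * 16 / 9) * (Real.pi / ((7 / 16) * d₀)) with hBpart
    have hBown0 : 0 ≤ Bown := (norm_nonneg _).trans hown
    have hBpart0 : 0 ≤ Bpart := by rw [hBpart]; positivity
    have hpiece : ∀ k, ‖piece k z‖ ≤ Bown + Bpart := by
      intro k
      by_cases hk : k = j
      · simp only [piece, if_pos hk]
        exact hown.trans (by linarith)
      · simp only [piece, if_neg hk]
        exact (hpart k hk).trans (by linarith)
    calc ‖∑ k, (((Γ * γ k / (4 * Real.pi) : ℝ)) : ℂ) • piece k z‖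
        ≤ ∑ k, ‖(((Γ * γ k / (4 * Real.pi) : ℝ)) : ℂ) • piece k z‖ := norm_sum_le _ _
      _ ≤ ∑ k, |Γ * γ k / (4 * Real.pi)| * (Bown + Bpart) := Finset.sum_le_sum fun k _ => by
          rw [norm_smul, Complex.norm_real, Real.norm_eq_abs]
          exact mul_le_mul_of_nonneg_left (hpiece k) (abs_nonneg _)
      _ = (∑ k, |Γ * γ k / (4 * Real.pi)|) * (Bown + Bpart) := by rw [Finset.sum_mul]

end Summit.NavierStokesRegularity.NavierStokesRegularity.Theorems.StadiumStripCore

end
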